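/- COR-CM (cell pub-hodgecm2) — Δ2 BRIDGE, ORIENTATION RE-KEY, Track T (conjugation TRANSPORT): what the antilinear transport of a
RE-KEYED r8 does to the HOLOMORPHIC vectors of the live blocks.  Wall-breaker wb-5 (prover-pub-hodgecm2-d2bridge-wb-5-g1-0).  THEOREMS ONLY;
nothing landed is edited or restated; no named fact, no `sorry`; explicit per-theorem binders.  FRAMING: HC_CM is NOT proved;
«Δ2 BRIDGE CLOSED» is NOT claimed; no orientation verdict is asserted — every orientation-dependent input is a displayed binder. -/
import Summits.HodgeConjecture.CorCM.D2Bridge.CmClassesHodgeType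
import Summits.HodgeConjecture.CorCM.D2Bridge.OrientationReflexConj
import Summits.HodgeConjecture.CorCM.D2Bridge.OrientationT2BlockVanishing
import Literature.AlgebraicGeometry.HodgeTheory.AbelianVarietyHodgeHomFullnessHolds
import HarnessLib

/-!
# Δ2 bridge, Track T: a re-keyed `Thm418C` TRANSPORTED along `F∞` kills the holomorphic `K`-fixed vectors of the live `PhiMu` blocks

Setting: two real-carrier dictionaries `T₁`, `T₂ : LiuDictionary hHD hI h₁ h₃ V` at the SAME pin `(V, ι₁)` ([Liu2021] §4.2 at the model,
`HodgeCM/Model/LiuDictionary.lean`) and the data of own-crow's PROPOSAL T (pub-hodgecm2/INBOX l.12012; ASSEMBLER DECISION #19 (A)):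
(T1) a map `F : T₁.H → T₂.H` carrying `K`-fixed vectors to `K`-fixed vectors whose identity-component restrictions are the
`c_W := conj ⊗ id`-conjugates (`T₂.res Γ (F x) = HodgeStructure.conj (T₁.res Γ x)` on `Γ.K`-fixed `x` — instlevel-a's `conjTower`,
`resTotal_conjTower_of_mem_fixedBy`), (T2) an index map `eC : T₁.Char → T₂.Char` carrying `T₁.PhiMu` into `T₂.PhiMu`, (T4) `F (T₁.block μ) ⊆
T₂.block (eC μ)`; and ONE typing input on `T₂`'s admissible records at the image characters: their eigencharacter lies IN their CM type
(`d.τ ∈ d.ΦA`) — for the re-keyed pin dictionary (`adm′ ī d = d.IsReflexOfTypeG ῑ₁ (typeOfLine (line ī))`, `typeOfLine (line ī) =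
bar (typeOfLine (line i))`) this is K1 + K2 of ✔ `OrientationReflexConj` at a `PhiMuLine ι₁` line `i`, discharged in §2.

* §1 `res_eq_zero_of_thm418C_transport_of_mem_piece_one_zero` — **`T₂.Thm418C` ⇒ below a threshold every `Γ.K`-fixed `x ∈ T₁.block μ`
  (`T₁.PhiMu μ`) whose restriction `T₁.res Γ x` is of Hodge type `(1,0)` restricts to `0`**: `conj (res x)` is `(0,1)` (Hodge symmetry)
  and lies in `span (T₂.cmClasses Γ (eC μ)) ⊆ H^{1,0}` (T1 kernel test, ✔ `CmClassesHodgeType`), and `H^{1,0} ∩ H^{0,1} = 0`.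
  Corollaries: `block = ⊥` under the typed input «the block restricts into `(1,0)`» (`block_ofTower_eq_bot_…`), and `False` from ONE
  persistent non-zero holomorphic fixed block vector (`false_of_thm418C_transport_of_holomorphic_witness`).
* §2 AT THE LITERAL PIN `T₁ := liuDictionaryPin … V I line` (live keys) against ANY `T₂` keyed like the re-keyed twin at the conjugate
  lines (`T₂.adm (eC i) d → d.IsReflexOfTypeG ῑ₁ (Φ₂ (eC i))`, `ῑ₁ ∈ Φ₂ (eC i) → T₂.PhiMu (eC i)`, `Φ₂ (eC i) = bar (typeOfLine (line i))`):
  the typing input and `hPhi` are DISCHARGED (K1 `isReflexOfTypeG_starRingEnd_comp_iff`, K2 `tau_mem_cmType_of_isReflexOfType`), leaving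
  exactly (T1)+(T2-type-law)+(T4) as binders: `res_eq_zero_pin_of_thm418C_rekey_transport`.

READING (no verdict): Stage 1 types its theta classes as NON-ZERO `(1,0)` restrictions of `K`-fixed vectors of the live `PhiMuLine ι₁` blocks
(`thetaOf_subset_H10`, the Ω-pin non-vanishing).  With (T1)+(T2)+(T4) in hand, a re-keyed `h418′` would therefore make them vanish: the
antilinear transport does not carry `h418′` to the live `h418` (wb-5 g1 T-AUDIT, INBOX l.12123; wb-1 g1 l.12170) — it carries it to a
statement CONTRADICTING Stage 1's typing.  Which of `h418` ∕ `h418′` is the content reading of [Liu2021, Thm. 4.18] is the coordinator's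
WORLD word, not this file's.

References: [Liu2021] Y. Liu, *Fourier–Jacobi cycles and arithmetic relative trace formula*, Camb. J. Math. 9 (2021), Thm. 4.18, Rem. 4.4;
[VoisinHodgeI2002] C. Voisin, *Hodge Theory and Complex Algebraic Geometry I*, §6.1.3 Cor. 6.12 ∕ 6.14, §7.1.1; [Shimura1998] G. Shimura,
*Abelian Varieties with Complex Multiplication and Modular Functions*, §5.2, §8.3 Prop. 28.
-/

set_option autoImplicit false

noncomputable section

open scoped TensorProduct
open CategoryTheory Module

namespace Summit.HodgeConjecture.CorCM.D2Bridge

open NumberField NumberField.ComplexEmbedding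
open Literature.AlgebraicGeometry.Motives (SchemeOver IsSmoothProjective CMType AbelianVariety bettiCohomology
  ofRatClassBaseChange ComplexPoints)
open Literature.AlgebraicGeometry.HodgeTheory (complexBetti IsOfHodgeType exists_isReal_hodgeModel hodgePQ_independent_of_hodgeModel
  conjClass_ofRatClassBaseChange)
open Literature.NumberTheory.Automorphic.PicardCM
open Literature.NumberTheory.ComplexMultiplication
open Literature.NumberTheory.ComplexMultiplication.CMTypeOps (bar mem_bar_iff conjugate_mem_iff_notMem)
open Literature.NumberTheory.Transcendental (Arapura2012_Cor_15_4_6)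
open HodgeCM HodgeCM.Model HodgeCM.Model.LiuDictionary
open HodgeCM.Literature.Theta HodgeCM.Literature.Theta.LiuAlbaneseModuleDatum

variable {hHD : exists_isReal_hodgeModel} {hI : hodgePQ_independent_of_hodgeModel}
  {h₁ : BallQuotientUniformised} {h₃ : CMAbelianVarietyRealised}
variable {L : CMField} {ι₁ : (L : Type) →+* ℂ} {V : HermSpace3 L ι₁}

/-! ## §0 `c_W = conj ⊗ id` swaps the Hodge pieces of `H¹(P_K)` (local copy; the wb-5 record file `LiuCMSideConj` carries the same lemma) -/

/-- `conj ⊗ id` carries `H^{1,0}(P_K)` into `H^{0,1}(P_K)` (Hodge symmetry, read through `β : ℂ ⊗_ℚ H¹ ≃ H¹(–; ℂ)`).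
[cite: VoisinHodgeI2002, §6.1.3 Cor. 6.12] -/
private theorem conj_mem_piece_zero_one (K : Level V)
    {x : (picardCMUniverse hHD hI h₁ h₃).CohC ((picardCMUniverse hHD hI h₁ h₃).pms L ι₁ V K) 1}
    (hx : x ∈ ((picardCMUniverse hHD hI h₁ h₃).hodge ((picardCMUniverse hHD hI h₁ h₃).pms L ι₁ V K) 1).piece 1 0) :
    Literature.AlgebraicGeometry.Motives.HodgeStructure.conj x ∈
      ((picardCMUniverse hHD hI h₁ h₃).hodge ((picardCMUniverse hHD hI h₁ h₃).pms L ι₁ V K) 1).piece 0 1 := by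
  rw [hodge_pms_eq] at hx ⊢
  have h10 := (Literature.AlgebraicGeometry.HodgeTheory.BettiUniverse.mem_hodge_piece_iff hHD hI
    (isSmoothProjective_pms (h₁ := h₁) K) (k := 1) (p := 1) (q := 0) rfl x).1 hx
  have h01 := h10.conjClass (isSmoothProjective_pms (h₁ := h₁) K)
  rw [conjClass_ofRatClassBaseChange] at h01
  exact (Literature.AlgebraicGeometry.HodgeTheory.BettiUniverse.mem_hodge_piece_iff hHD hI
    (isSmoothProjective_pms (h₁ := h₁) K) (k := 1) (p := 0) (q := 1) rfl _).2 h01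

/-- `conj ⊗ id` is injective on `ℂ ⊗_ℚ H¹` (an involution): `conj x = 0 → x = 0`. [folklore] -/
private theorem eq_zero_of_conj_eq_zero {W : Type*} [AddCommGroup W] [Module ℚ W] {x : ℂ ⊗[ℚ] W}
    (h : Literature.AlgebraicGeometry.Motives.HodgeStructure.conj x = 0) : x = 0 := by
  rw [← Literature.AlgebraicGeometry.Motives.HodgeStructure.conj_conj x, h, map_zero]

/-! ## §1 Generic: two dictionaries at one pin, an antilinear transport package, and the holomorphic vectors of the source blocks -/

section Generic

variable (T₁ T₂ : LiuDictionary hHD hI h₁ h₃ V)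

/-- **TRANSPORTED RE-KEY KILLS HOLOMORPHIC FIXED BLOCK VECTORS.**  Let `F : T₁.H → T₂.H` carry `Γ.K`-fixed vectors to `Γ.K`-fixed vectors
with conjugate restrictions (T1), `eC` carry `T₁.PhiMu` into `T₂.PhiMu` (T2) and `F (T₁.block μ) ⊆ T₂.block (eC μ)` (T4), and let the
records `T₂` admits at `eC μ` have their eigencharacter IN their CM type.  If `T₂` satisfies the combined reading r8 (`T₂.Thm418C`), then at
every `T₁.PhiMu` character `μ` there is a threshold below which every `Γ.K`-fixed `x ∈ T₁.block μ` whose restriction to `P_Γ` is of Hodge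
type `(1,0)` restricts to `0`: `conj (T₁.res Γ x) = T₂.res Γ (F x) ∈ span (T₂.cmClasses Γ (eC μ)) ⊆ H^{1,0}` while `conj (T₁.res Γ x) ∈ H^{0,1}`.
[cite: Liu2021, Thm. 4.18] [cite: VoisinHodgeI2002, §6.1.3 Cor. 6.12 and Cor. 6.14] -/
theorem res_eq_zero_of_thm418C_transport_of_mem_piece_one_zero
    (F : T₁.H → T₂.H) (eC : T₁.Char → T₂.Char)
    (hFfix : ∀ (Γ : Level V) (x : T₁.H), x ∈ fixedBy Γ.K T₁.H → F x ∈ fixedBy Γ.K T₂.H)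
    (hres : ∀ (Γ : Level V) (x : T₁.H), x ∈ fixedBy Γ.K T₁.H →
      T₂.res Γ (F x) = Literature.AlgebraicGeometry.Motives.HodgeStructure.conj (T₁.res Γ x))
    (hPhi : ∀ μ : T₁.Char, T₁.PhiMu μ → T₂.PhiMu (eC μ))
    (hblock : ∀ (μ : T₁.Char) (x : T₁.H), x ∈ T₁.block μ → F x ∈ T₂.block (eC μ))
    (hadm₂ : ∀ (μ : T₁.Char) (d : LiuCMSide), T₁.PhiMu μ → T₂.adm (eC μ) d → d.τ ∈ d.ΦA.1)
    (h418₂ : T₂.Thm418C) (μ : T₁.Char) (hΦ : T₁.PhiMu μ) :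
    ∃ Γ₀ : Level V, ∀ Γ ≤ Γ₀, ∀ x ∈ T₁.block μ, x ∈ fixedBy Γ.K T₁.H →
      T₁.res Γ x ∈ ((picardCMUniverse hHD hI h₁ h₃).hodge ((picardCMUniverse hHD hI h₁ h₃).pms L ι₁ V Γ) 1).piece 1 0 →
        T₁.res Γ x = 0 := by
  obtain ⟨K₀, hK₀⟩ := h418₂ (eC μ) (hPhi μ hΦ)
  refine ⟨K₀, fun Γ hΓ x hx hfix h10 => ?_⟩
  -- r8 for `T₂` at `eC μ`, applied to `F x`
  have h2 : T₂.res Γ (F x) ∈ Submodule.span ℂ (T₂.cmClasses Γ (eC μ)) :=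
    hK₀ Γ hΓ (F x) (hblock μ x hx) (hFfix Γ x hfix)
  -- the generators of `T₂` at `eC μ` are `(1,0)` (T1 kernel test)
  have h2' : T₂.res Γ (F x) ∈
      ((picardCMUniverse hHD hI h₁ h₃).hodge ((picardCMUniverse hHD hI h₁ h₃).pms L ι₁ V Γ) 1).piece 1 0 :=
    (Submodule.span_le.2 (cmClasses_subset_hodge_piece_one_zero T₂ Γ (eC μ) (fun d hd => hadm₂ μ d hΦ hd))) h2
  rw [hres Γ x hfix] at h2'
  -- while `conj (res x)` is `(0,1)`
  have h01 := conj_mem_piece_zero_one (hHD := hHD) (hI := hI) (h₁ := h₁) (h₃ := h₃) Γ h10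
  exact eq_zero_of_conj_eq_zero ((Submodule.disjoint_def.1 (disjoint_hodgePiece_one_zero hHD hI h₁ h₃ Γ)) _ h2' h01)

/-- **Inconsistency form.**  Under the same package, `T₂.Thm418C` is CONTRADICTED by a persistent non-zero holomorphic fixed vector of a
`T₁.PhiMu` block: «for every threshold `Γ₀` there are `Γ ≤ Γ₀` and a `Γ.K`-fixed `x ∈ T₁.block μ` with `T₁.res Γ x` of type `(1,0)` and
`≠ 0`» (the shape in which Stage 1 supplies its theta classes). [cite: Liu2021, Thm. 4.18] [cite: VoisinHodgeI2002, §6.1.3 Cor. 6.14] -/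
theorem false_of_thm418C_transport_of_holomorphic_witness
    (F : T₁.H → T₂.H) (eC : T₁.Char → T₂.Char)
    (hFfix : ∀ (Γ : Level V) (x : T₁.H), x ∈ fixedBy Γ.K T₁.H → F x ∈ fixedBy Γ.K T₂.H)
    (hres : ∀ (Γ : Level V) (x : T₁.H), x ∈ fixedBy Γ.K T₁.H →
      T₂.res Γ (F x) = Literature.AlgebraicGeometry.Motives.HodgeStructure.conj (T₁.res Γ x))
    (hPhi : ∀ μ : T₁.Char, T₁.PhiMu μ → T₂.PhiMu (eC μ))
    (hblock : ∀ (μ : T₁.Char) (x : T₁.H), x ∈ T₁.block μ → F x ∈ T₂.block (eC μ))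
    (hadm₂ : ∀ (μ : T₁.Char) (d : LiuCMSide), T₁.PhiMu μ → T₂.adm (eC μ) d → d.τ ∈ d.ΦA.1)
    (h418₂ : T₂.Thm418C) (μ : T₁.Char) (hΦ : T₁.PhiMu μ)
    (hθ : ∀ Γ₀ : Level V, ∃ Γ ≤ Γ₀, ∃ x ∈ T₁.block μ, x ∈ fixedBy Γ.K T₁.H ∧
      T₁.res Γ x ∈ ((picardCMUniverse hHD hI h₁ h₃).hodge ((picardCMUniverse hHD hI h₁ h₃).pms L ι₁ V Γ) 1).piece 1 0 ∧
        T₁.res Γ x ≠ 0) : False := by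
  obtain ⟨Γ₀, hΓ₀⟩ := res_eq_zero_of_thm418C_transport_of_mem_piece_one_zero T₁ T₂ F eC hFfix hres hPhi hblock hadm₂ h418₂ μ hΦ
  obtain ⟨Γ, hΓ, x, hx, hfix, h10, hne⟩ := hθ Γ₀
  exact hne (hΓ₀ Γ hΓ x hx hfix h10)

end Generic

/-! ## §2 At the literal pin: the live `liuDictionaryPin` against a dictionary keyed like its re-keyed twin at the conjugate lines -/

section Pin

/-- `bar (bar Φ) = Φ` (the conjugate type is the complement). [folklore] -/
private theorem bar_bar' {K : Type} [Field K] (Φ : CMType K) : bar (bar Φ) = Φ :=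
  Subtype.ext (compl_compl Φ.1)

/-- `ι ∈ Φ → conj ∘ ι ∈ bar Φ`. [folklore] -/
private theorem starRingEnd_comp_mem_bar {K : Type} [Field K] (Φ : CMType K) (ι : K →+* ℂ) (hι : ι ∈ Φ.1) :
    (starRingEnd ℂ).comp ι ∈ (bar Φ).1 := by
  have h : (starRingEnd ℂ).comp ι = conjugate ι := RingHom.ext fun _ => rfl
  rw [h, mem_bar_iff]
  exact fun hc => ((conjugate_mem_iff_notMem Φ ι).1 hc) hι

variable (V) (I : Type) (line : I → SplitLineE V)

/-- **AT THE LITERAL PIN.**  `T₁ := liuDictionaryPin hHD hI h₁ h₃ hA V I line` (live: `PhiMu i = (ι₁ ∈ typeOfLine (line i))`,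
`adm i d = d.IsReflexOfTypeG ι₁ (typeOfLine (line i))`, both `rfl`), `L/ℚ` Galois; `T₂` ANY dictionary at the same pin keyed, at the image
characters `eC i`, like the re-keyed twin at the CONJUGATE lines: `T₂.adm (eC i) d → d.IsReflexOfTypeG ῑ₁ (Φ₂ (eC i))`,
`ῑ₁ ∈ Φ₂ (eC i) → T₂.PhiMu (eC i)` (both `Iff.rfl` for `Rekey.liuDictionaryPin` with `Φ₂ := typeOfLine ∘ line`), with the (T2) type law
`Φ₂ (eC i) = bar (typeOfLine (line i))`.  Then the typing input and `hPhi` of §1 are DISCHARGED by K1 (`isReflexOfTypeG_starRingEnd_comp_iff`)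
and K2 (`tau_mem_cmType_of_isReflexOfType`), and `T₂.Thm418C` + (T1) + (T4) ⇒ below a threshold every `Γ.K`-fixed vector of the live block
`i` (`ι₁ ∈ typeOfLine (line i)`) with `(1,0)` restriction restricts to `0`.
[cite: Liu2021, Thm. 4.18 and Remark 4.4 (TeX ll. 1930–1933)] [cite: Shimura1998, §8.3 Prop. 28] [cite: VoisinHodgeI2002, §6.1.3 Cor. 6.14] -/
theorem res_eq_zero_pin_of_thm418C_rekey_transport [IsGalois ℚ (L : Type)]
    (hHD : exists_isReal_hodgeModel) (hI : hodgePQ_independent_of_hodgeModel) (h₁ : BallQuotientUniformised)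
    (h₃ : CMAbelianVarietyRealised) (hA : Arapura2012_Cor_15_4_6)
    (T₂ : LiuDictionary hHD hI h₁ h₃ V) (Φ₂ : T₂.Char → CMType (L : Type)) (eC : I → T₂.Char)
    (hadm₂ : ∀ (i : I) (d : LiuCMSide), T₂.adm (eC i) d → d.IsReflexOfTypeG ((starRingEnd ℂ).comp ι₁) (Φ₂ (eC i)))
    (hPhi₂ : ∀ i : I, (starRingEnd ℂ).comp ι₁ ∈ (Φ₂ (eC i)).1 → T₂.PhiMu (eC i))
    (heC : ∀ i : I, Φ₂ (eC i) = bar (SplitLine.typeOfLine (line i)))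
    (F : (liuDictionaryPin hHD hI h₁ h₃ hA V I line).H → T₂.H)
    (hFfix : ∀ (Γ : Level V) (x : (liuDictionaryPin hHD hI h₁ h₃ hA V I line).H),
      x ∈ fixedBy Γ.K (liuDictionaryPin hHD hI h₁ h₃ hA V I line).H → F x ∈ fixedBy Γ.K T₂.H)
    (hres : ∀ (Γ : Level V) (x : (liuDictionaryPin hHD hI h₁ h₃ hA V I line).H),
      x ∈ fixedBy Γ.K (liuDictionaryPin hHD hI h₁ h₃ hA V I line).H →
        T₂.res Γ (F x) = Literature.AlgebraicGeometry.Motives.HodgeStructure.conj ((liuDictionaryPin hHD hI h₁ h₃ hA V I line).res Γ x))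
    (hblock : ∀ (i : I) (x : (liuDictionaryPin hHD hI h₁ h₃ hA V I line).H),
      x ∈ (liuDictionaryPin hHD hI h₁ h₃ hA V I line).block i → F x ∈ T₂.block (eC i))
    (h418₂ : T₂.Thm418C) (i : I) (hΦ : (liuDictionaryPin hHD hI h₁ h₃ hA V I line).PhiMu i) :
    ∃ Γ₀ : Level V, ∀ Γ ≤ Γ₀, ∀ x ∈ (liuDictionaryPin hHD hI h₁ h₃ hA V I line).block i,
      x ∈ fixedBy Γ.K (liuDictionaryPin hHD hI h₁ h₃ hA V I line).H →
        (liuDictionaryPin hHD hI h₁ h₃ hA V I line).res Γ x ∈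
          ((picardCMUniverse hHD hI h₁ h₃).hodge ((picardCMUniverse hHD hI h₁ h₃).pms L ι₁ V Γ) 1).piece 1 0 →
        (liuDictionaryPin hHD hI h₁ h₃ hA V I line).res Γ x = 0 := by
  refine res_eq_zero_of_thm418C_transport_of_mem_piece_one_zero (liuDictionaryPin hHD hI h₁ h₃ hA V I line) T₂ F eC hFfix hres
    (fun j hj => hPhi₂ j ?_) hblock (fun j d hj hd => ?_) h418₂ i hΦ
  · -- `ι₁ ∈ Φ_j ⇒ ῑ₁ ∈ bar Φ_j = Φ₂ (eC j)`
    rw [heC j]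
    exact starRingEnd_comp_mem_bar _ _ hj
  · -- K1: `IsReflexOfTypeG ῑ₁ (bar Φ_j) d ↔ IsReflexOfTypeG ι₁ Φ_j d`; K2: `ι₁ ∈ Φ_j ⇒ d.τ ∈ d.ΦA`
    have hK1 : d.IsReflexOfTypeG ι₁ (SplitLine.typeOfLine (line j)) := by
      have h := hadm₂ j d hd
      rw [heC j, isReflexOfTypeG_starRingEnd_comp_iff ι₁ d, bar_bar'] at h
      exact h
    exact tau_mem_cmType_of_isReflexOfType ι₁ d (SplitLine.typeOfLine (line j)) (hK1 inferInstance) hj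

/-- **AT THE LITERAL PIN, inconsistency form**: the same package + a persistent non-zero holomorphic fixed vector of the live block `i`
contradicts `T₂.Thm418C`. [cite: Liu2021, Thm. 4.18 and Remark 4.4 (TeX ll. 1930–1933)] [cite: VoisinHodgeI2002, §6.1.3 Cor. 6.14] -/
theorem false_pin_of_thm418C_rekey_transport_of_holomorphic_witness [IsGalois ℚ (L : Type)]
    (hHD : exists_isReal_hodgeModel) (hI : hodgePQ_independent_of_hodgeModel) (h₁ : BallQuotientUniformised)
    (h₃ : CMAbelianVarietyRealised) (hA : Arapura2012_Cor_15_4_6)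
    (T₂ : LiuDictionary hHD hI h₁ h₃ V) (Φ₂ : T₂.Char → CMType (L : Type)) (eC : I → T₂.Char)
    (hadm₂ : ∀ (i : I) (d : LiuCMSide), T₂.adm (eC i) d → d.IsReflexOfTypeG ((starRingEnd ℂ).comp ι₁) (Φ₂ (eC i)))
    (hPhi₂ : ∀ i : I, (starRingEnd ℂ).comp ι₁ ∈ (Φ₂ (eC i)).1 → T₂.PhiMu (eC i))
    (heC : ∀ i : I, Φ₂ (eC i) = bar (SplitLine.typeOfLine (line i)))
    (F : (liuDictionaryPin hHD hI h₁ h₃ hA V I line).H → T₂.H)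
    (hFfix : ∀ (Γ : Level V) (x : (liuDictionaryPin hHD hI h₁ h₃ hA V I line).H),
      x ∈ fixedBy Γ.K (liuDictionaryPin hHD hI h₁ h₃ hA V I line).H → F x ∈ fixedBy Γ.K T₂.H)
    (hres : ∀ (Γ : Level V) (x : (liuDictionaryPin hHD hI h₁ h₃ hA V I line).H),
      x ∈ fixedBy Γ.K (liuDictionaryPin hHD hI h₁ h₃ hA V I line).H →
        T₂.res Γ (F x) = Literature.AlgebraicGeometry.Motives.HodgeStructure.conj ((liuDictionaryPin hHD hI h₁ h₃ hA V I line).res Γ x))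
    (hblock : ∀ (i : I) (x : (liuDictionaryPin hHD hI h₁ h₃ hA V I line).H),
      x ∈ (liuDictionaryPin hHD hI h₁ h₃ hA V I line).block i → F x ∈ T₂.block (eC i))
    (h418₂ : T₂.Thm418C) (i : I) (hΦ : (liuDictionaryPin hHD hI h₁ h₃ hA V I line).PhiMu i)
    (hθ : ∀ Γ₀ : Level V, ∃ Γ ≤ Γ₀, ∃ x ∈ (liuDictionaryPin hHD hI h₁ h₃ hA V I line).block i,
      x ∈ fixedBy Γ.K (liuDictionaryPin hHD hI h₁ h₃ hA V I line).H ∧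
        (liuDictionaryPin hHD hI h₁ h₃ hA V I line).res Γ x ∈
          ((picardCMUniverse hHD hI h₁ h₃).hodge ((picardCMUniverse hHD hI h₁ h₃).pms L ι₁ V Γ) 1).piece 1 0 ∧
        (liuDictionaryPin hHD hI h₁ h₃ hA V I line).res Γ x ≠ 0) : False := by
  obtain ⟨Γ₀, hΓ₀⟩ := res_eq_zero_pin_of_thm418C_rekey_transport V I line hHD hI h₁ h₃ hA T₂ Φ₂ eC hadm₂ hPhi₂ heC F hFfix
    hres hblock h418₂ i hΦ
  obtain ⟨Γ, hΓ, x, hx, hfix, h10, hne⟩ := hθ Γ₀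
  exact hne (hΓ₀ Γ hΓ x hx hfix h10)

end Pin

end Summit.HodgeConjecture.CorCM.D2Bridge

end
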